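import Summits.QuantumFields.YangMills.Theorems.BalabanUVNodesN07SocketFlatAtRecordLam
import Summits.QuantumFields.YangMills.Theorems.BalabanUVNodesK0Stub1SectFWSlotAtRecordFlatScaledExistsHerm0
import Summits.QuantumFields.YangMills.Theorems.BalabanUVNodesK0Stub1FlatHRescaledRowsAtRecord
import HarnessLib

/-!
# N07 (d′)-Lam, (R1) W3: Sect. F's ♭ current + (98)-slot + reality + the ♭ (127) socket, ∃-package, criticality in CELL FORM (S4-Lam, third wrapper)

WHY (n07-e memo `LOCATED-DPRIME-CALIBRATION` §4 (R1), `DPRIME-LAM-ROADMAP` §2).  k0-s1-w2's `K0Stub1SocketFlatAtRecordExists.exists_sectF_W_flatScaled_atRecord_socket` (no letter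
hypothesis: thresholds and all chart ∕ current objects supplied) states its socket clause with `IsCritOnFibre F N K 𝔹 …` for a determining set `𝔹` of (2.3) index bonds — more
than print's criticality ([15] (156)–(157)), which is all the N07 head token supplies at a datum (n07-e MODULES 101–104).  This file is the same package with the socket clause
in cell form, over n07-e W2-Lam (`…N07SocketFlatAtRecordLam`); W4-Lam ∕ W5-Lam (the (158) letters `Letters10On`) continue from it.

WHAT IS PROVED (sorry-free; no definition; axioms standard): ★★★★ `exists_sectF_W_flatScaled_atRecord_socket_lam` — k0-s1-w2's statement VERBATIM with the socket clause's
binders `∀ 𝔹, (bondsOf 𝔹 ⊆ LamBonds ≤ K − n) → ∀ U₁, (reading) → IsCritOnFibre … →` replaced by `∀ U₁, (reading) → (cell-form criticality) →`; proof VERBATIM (k0-s1-w4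
`exists_sectF_W_flatScaled_atRecord_herm0`, `rescaledRows_of_adm22_T4` cited by name) over `socket127_flat_of_letters_lam`.
HONEST FRAMING: a re-cut of one wrapper, no new analysis; NOTHING of [15]'s estimates asserted beyond what the cited k0-s1 files prove; (d′) ∕ `HThm4RecDbar` ∕ budget row of
MODULE 100 untouched; K0⁷ NOT closed; N07 NOT discharged; counts unmoved; one finite 𝕋⁴ programme at fixed ε — NOT continuum ∕ ℝ⁴ ∕ OS ∕ mass gap ∕ Clay.  No `sorry`, no
`def`, no `instance`, no `notation`.

References: [15] = Balaban1985Variational (27) p.282, (44)–(50) p.285, (55) p.286, (80) p.290, (127)–(128) p.297, (152) p.301, (156)–(158) p.302; Balaban1985Averaging (92) p.31,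
Prop. 4 (134)–(135) p.38; Balaban1984PropagatorsII (2.3) p.224, (2.35) p.228; Balaban1988Convergent (2.10)–(2.12) p.256; Balaban1987RG1 (0.1) p.251.
-/

set_option autoImplicit false

noncomputable section

open scoped BigOperators Matrix InnerProductSpace RealInnerProductSpace Matrix.Norms.L2Operator Topology ContDiff

namespace Summit.QuantumFields.YangMills.BalabanUVNodes.N07SocketFlatAtRecordExistsLam

open Literature.MathematicalPhysics.QuantumFieldTheory.Balaban1983to89
open Literature.MathematicalPhysics.QuantumFieldTheory.Balaban1983to89.Node00
open T4Continuum (T4Family)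
open ExpMeanLog (deltaSU deltaSU_pos)
open T4AdjointCovarianceUnitary (lieSU)
open B9AdOrthogonal (herm0)
open B9Eq39Adjoint (bondPair)
open B15DeterminingSets (bondsOf DetSet avgFamily)
open B6SectADomainsV1 (Domains)
open B6SectAOperatorsV1 (BondIdx aE)
open B6SectAVectorModelV1 (EE)
open B11Eq26ActionExpansion (V0)
open B4Sect5Torus (TSite)
open MatrixNorms (ntr)
open Summit.QuantumFields.YangMills.Theorems.FlatCubeOpsText (Adm22)
open Summit.QuantumFields.YangMills.Theorems.K0FlatCubeOpsTextP (IsLevWeight flatH)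
open Summit.QuantumFields.YangMills.Theorems.Prop8Chart (expCfg collar_of_adm22)
open Summit.QuantumFields.YangMills.Theorems.Prop8ChartDoubleBar (chartLogFlat)
open Summit.QuantumFields.YangMills.Theorems.K0Stub1SectFWSlotAtRecordFlatScaledExistsHerm0 (exists_sectF_W_flatScaled_atRecord_herm0)
open Summit.QuantumFields.YangMills.Theorems.K0Stub1FlatHRescaledRowsAtRecord (rescaledRows_of_adm22_T4)
open Summit.QuantumFields.YangMills.BalabanUVNodes.N07SocketFlatAtRecordLam (socket127_flat_of_letters_lam)

/-- ★★★★ **SECT. F's ♭ CURRENT AT THE RECORD WITH THE (98)-SLOT, THE REALITY OF THE CHART AND THE ♭ (127) SOCKET — CELL-FORM (Lam) EDITION** of k0-s1-w2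
`K0Stub1SocketFlatAtRecordExists.exists_sectF_W_flatScaled_atRecord_socket`: the SAME ∃-package (thresholds `Mh₀ R₀ ε C₄`, the letters `τ ρ BE B`, `M♭`, `H♭` with its kernel
formula, `Dsel` with (55)♭ ∕ `ContDiffOn ℂ ω` ∕ (48)♭ ∕ (49)♭ ∕ reality, the transposes, Sect. F's `e`, `W` with (157)–(158)), and the SAME socket clause, EXCEPT that the socket
clause asks the criticality of the charted configuration `U₁` in the CORE's cell form (stationarity of `𝔄` along differentiable `SU(N)` curves through `U₁` keeping the averages
`avgFamily (avOfRecord F N K) · j c` on the (2.3) CELLS `D.LamBond j c`, `j ≤ K − n`) instead of `IsCritOnFibre F N K 𝔹 …` for a determining set `𝔹`.  Proof = k0-s1-w2's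
VERBATIM over n07-e W2-Lam `socket127_flat_of_letters_lam`.  (The (50) uniqueness row of `Dsel`, needed downstream by n07-e MODULE 105 §1, is NOT re-exported here: it is
recovered from k0-s1-w4 `K0Stub1FlatChartDImplicit.exists_analytic_chartDFlat` ∕ `K0Stub1ChartDAnalytic.chartD_unique` and the exported (48)♭ + (55)♭ rows.)
[cite: Balaban1985Variational, (27) p.282, (44)-(50) p.285, (55) p.286, (80) p.290, (127)-(128) p.297, (152) p.301, (156)-(158) p.302; Balaban1985Averaging, (92) p.31, Prop. 4 (134)-(135) p.38; Balaban1984PropagatorsII, (2.3) p.224, (2.35) p.228; Balaban1988Convergent, (2.10)-(2.12) p.256] -/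
theorem exists_sectF_W_flatScaled_atRecord_socket_lam (N : ℕ) [NeZero N] (F : T4Family) :
    ∃ (Mh₀ R₀ : ℕ) (ε C₄ : ℝ), 0 < ε ∧ 0 ≤ C₄ ∧
    ∀ (n K : ℕ) (_ : 1 ≤ K - n) (_ : K - n + 1 ≤ F.m + K) {Mh R a' : ℕ} (_ : Mh = F.L ^ a') (_ : Mh₀ ≤ Mh) (_ : R₀ ≤ R)
      (_ : a' + 3 ≤ F.m + n) (D : Domains (F.P K)) (_ : D.k = K - n) (_ : Adm22 D R (F.L * Mh))
      {w : ℕ → PBond (F.P K) 0 → ℝ} (_ : IsLevWeight (F.P K) (K - n) D w),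
    ∃ (τ : Matrix (Fin N) (Fin N) ℂ →L[ℂ] ℂ) (ρ : (Matrix (Fin N) (Fin N) ℂ →L[ℂ] ℂ) →L[ℂ] Matrix (Fin N) (Fin N) ℂ)
      (BE : (PBond (F.P K) 0 → Matrix (Fin N) (Fin N) ℂ) →L[ℂ] (PBond (F.P K) 0 → Matrix (Fin N) (Fin N) ℂ) →L[ℂ] ℂ)
      (B : (BondIdx D → Matrix (Fin N) (Fin N) ℂ) →L[ℂ] (BondIdx D → Matrix (Fin N) (Fin N) ℂ) →L[ℂ] ℂ)
      (hc : ((F.P K).L : ℝ) ^ (K - n) ≠ 0) (hwa : ∀ _i : BondIdx D, (0 : ℝ) < 1)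
      (MV : (BondIdx D → Matrix (Fin N) (Fin N) ℂ) →L[ℂ] (BondIdx D → Matrix (Fin N) (Fin N) ℂ))
      (H : (BondIdx D → Matrix (Fin N) (Fin N) ℂ) →ₗ[ℂ] (PBond (F.P K) 0 → Matrix (Fin N) (Fin N) ℂ))
      (Dsel : (PBond (F.P K) 0 → Matrix (Fin N) (Fin N) ℂ) → (BondIdx D → Matrix (Fin N) (Fin N) ℂ))
      (Qt : (BondIdx D → Matrix (Fin N) (Fin N) ℂ) →L[ℂ] (PBond (F.P K) 0 → Matrix (Fin N) (Fin N) ℂ))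
      (Ht : (PBond (F.P K) 0 → Matrix (Fin N) (Fin N) ℂ) →L[ℂ] (BondIdx D → Matrix (Fin N) (Fin N) ℂ))
      (Dt : (PBond (F.P K) 0 → Matrix (Fin N) (Fin N) ℂ) → ((BondIdx D → Matrix (Fin N) (Fin N) ℂ) →L[ℂ] (PBond (F.P K) 0 → Matrix (Fin N) (Fin N) ℂ)))
      (e : Site (F.P K) 0 ≃ TSite (F.P K).d (fun _ => (F.P K).sitesPerDir 0))
      (W : (PBond (F.P K) 0 → Matrix (Fin N) (Fin N) ℂ) → (PBond (F.P K) 0 → Matrix (Fin N) (Fin N) ℂ)),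
      -- the objects of record
      (∀ X, τ X = ntr X) ∧ (∀ (ℓ' : Matrix (Fin N) (Fin N) ℂ →L[ℂ] ℂ) (X : Matrix (Fin N) (Fin N) ℂ), τ (ρ ℓ' * X) = ℓ' X) ∧
      (∀ Y δ : PBond (F.P K) 0 → Matrix (Fin N) (Fin N) ℂ, BE Y δ =
        bondPair ((((F.P K).L : ℝ))⁻¹ ^ (K - n)) (F.P K).d (τ : Matrix (Fin N) (Fin N) ℂ →ₗ[ℂ] ℂ) (fun μ x => Y ⟨x, μ⟩) (fun μ x => δ ⟨x, μ⟩)) ∧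
      (∀ X X' : BondIdx D → Matrix (Fin N) (Fin N) ℂ, B X X' = ∑ t, τ (X t * X' t)) ∧
      (∀ (X : BondIdx D → Matrix (Fin N) (Fin N) ℂ) (t : BondIdx D),
        MV X t = ∑ s, (((((F.P K).L : ℝ) ^ (t.1.1 : ℕ) * ((((F.P K).L : ℝ))⁻¹) ^ (K - n))⁻¹ *
          WithLp.ofLp ((EE D hc hwa - aE D (fun _ => (1 : ℝ))) (WithLp.toLp 2 (Pi.single s 1))) t *
          (((F.P K).L : ℝ) ^ (s.1.1 : ℕ) * ((((F.P K).L : ℝ))⁻¹) ^ (K - n))⁻¹ : ℝ) : ℂ) • X s) ∧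
      (∀ (X : BondIdx D → Matrix (Fin N) (Fin N) ℂ) (b : PBond (F.P K) 0), H X b =
        ∑ t, (((((F.P K).L : ℝ) ^ (t.1.1 : ℕ) * ((((F.P K).L : ℝ))⁻¹) ^ (K - n))⁻¹ * flatH (F.P K) (K - n) D (Pi.single t 1) b : ℝ) : ℂ) • X t) ∧
      -- the implicit ♭ chart on the `ε`-ball: (55)♭, analyticity, (49)♭, (48)♭
      (∀ A' : PBond (F.P K) 0 → Matrix (Fin N) (Fin N) ℂ, (∀ b, w 1 b * ‖A' b‖ < ε) →
        ∀ ρ' : ℝ, 0 ≤ ρ' → (∀ b, w 1 b * ‖A' b‖ ≤ ρ') → ∀ i : BondIdx D, ‖Dsel A' i‖ ≤ C₄ * ρ' ^ 2) ∧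
      ContDiffOn ℂ ω Dsel {Y : PBond (F.P K) 0 → Matrix (Fin N) (Fin N) ℂ | ∀ b, w 1 b * ‖Y b‖ < ε} ∧
      (∀ A' : PBond (F.P K) 0 → Matrix (Fin N) (Fin N) ℂ, (∀ b, w 1 b * ‖A' b‖ < ε) →
        chartLogFlat (((((F.P K).L : ℝ))⁻¹) ^ (K - n)) D (A' - H (Dsel A')) - (fderiv ℂ (chartLogFlat (((((F.P K).L : ℝ))⁻¹) ^ (K - n)) D :
        (PBond (F.P K) 0 → Matrix (Fin N) (Fin N) ℂ) → BondIdx D → Matrix (Fin N) (Fin N) ℂ) 0) (A' - H (Dsel A')) = Dsel A' ∧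
        chartLogFlat (((((F.P K).L : ℝ))⁻¹) ^ (K - n)) D (A' - H (Dsel A')) = (fderiv ℂ (chartLogFlat (((((F.P K).L : ℝ))⁻¹) ^ (K - n)) D :
        (PBond (F.P K) 0 → Matrix (Fin N) (Fin N) ℂ) → BondIdx D → Matrix (Fin N) (Fin N) ℂ) 0) A') ∧
      -- the reality of the implicit ♭ chart on Hermitian-traceless fields (dag-k0-s1-w4 CLAIM-8, threaded through C‴)
      (∀ A' : PBond (F.P K) 0 → Matrix (Fin N) (Fin N) ℂ, (∀ b, w 1 b * ‖A' b‖ < ε) → (∀ b, A' b ∈ herm0 (Fin N)) →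
        (∀ i, Dsel A' i ∈ herm0 (Fin N)) ∧ ∀ b, (A' - H (Dsel A')) b ∈ herm0 (Fin N)) ∧
      -- the transposes
      (∀ X δ, BE (Qt X) δ = B X ((fderiv ℂ (chartLogFlat (((((F.P K).L : ℝ))⁻¹) ^ (K - n)) D :
        (PBond (F.P K) 0 → Matrix (Fin N) (Fin N) ℂ) → BondIdx D → Matrix (Fin N) (Fin N) ℂ) 0) δ)) ∧
      (∀ Z X, BE Z (H X) = B (Ht Z) X) ∧
      (∀ (A' : PBond (F.P K) 0 → Matrix (Fin N) (Fin N) ℂ) X δ, BE (Dt A' X) δ = B X (fderiv ℂ Dsel A' δ)) ∧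
      -- the chart, (157), the window, the (158)∕(98) row
      (∀ (x : Site (F.P K) 0) (μ : Fin (F.P K).d), e (x.shift μ) = B9SectCLatticeCarrier.shift μ (e x)) ∧
      (∀ A' : PBond (F.P K) 0 → Matrix (Fin N) (Fin N) ℂ, (∀ b, w 1 b * ‖A' b‖ < ε) →
        (∀ (b : PBond (F.P K) 0) (ν : Fin (F.P K).d), w 2 b * ((F.P K).L : ℝ) ^ (K - n) * ‖A' ⟨b.src.shift ν, b.dir⟩ - A' b‖ < ε) →
        HasFDerivAt (fun A : PBond (F.P K) 0 → Matrix (Fin N) (Fin N) ℂ => 2⁻¹ * B (Dsel A) (((((((((F.P K).L : ℝ))⁻¹) ^ (K - n) : ℝ) : ℂ) ^ (F.P K).d) • MV) (Dsel A))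
            - B ((fderiv ℂ (chartLogFlat (((((F.P K).L : ℝ))⁻¹) ^ (K - n)) D :
        (PBond (F.P K) 0 → Matrix (Fin N) (Fin N) ℂ) → BondIdx D → Matrix (Fin N) (Fin N) ℂ) 0) A)
                (((((((((F.P K).L : ℝ))⁻¹) ^ (K - n) : ℝ) : ℂ) ^ (F.P K).d) • MV) (Dsel A))
            + V0 (LatticeFieldCalculus.shiftEquiv (P := F.P K) (j := 0)) (fun _ _ => (1 : (Matrix (Fin N) (Fin N) ℂ)ˣ)) ((((F.P K).L : ℝ)⁻¹) ^ (K - n)) (F.P K).d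
                (τ : Matrix (Fin N) (Fin N) ℂ →ₗ[ℂ] ℂ) (fun μ x => (A - H (Dsel A)) ⟨x, μ⟩))
          (BE (W A')) A') ∧
      DifferentiableOn ℂ W {Y : PBond (F.P K) 0 → Matrix (Fin N) (Fin N) ℂ | (∀ b, w 1 b * ‖Y b‖ < ε) ∧
        ∀ (b : PBond (F.P K) 0) (ν : Fin (F.P K).d), w 2 b * ((F.P K).L : ℝ) ^ (K - n) * ‖Y ⟨b.src.shift ν, b.dir⟩ - Y b‖ < ε} ∧
      (∀ (Y : PBond (F.P K) 0 → Matrix (Fin N) (Fin N) ℂ) (r : ℝ), r < ε → (∀ b, w 1 b * ‖Y b‖ ≤ r) →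
        (∀ (b : PBond (F.P K) 0) (ν : Fin (F.P K).d), w 2 b * ((F.P K).L : ℝ) ^ (K - n) * ‖Y ⟨b.src.shift ν, b.dir⟩ - Y b‖ ≤ r) →
        ∀ b, w 3 b * ‖W Y b‖ ≤ C₄ * r ^ 2) ∧
      -- ★ THE ♭ (127) SOCKET: small Hermitian-traceless base points whose charted configuration is critical on the record's fibre, kernel directions
      (∀ (A₁ δ : PBond (F.P K) 0 → Matrix (Fin N) (Fin N) ℂ), (∀ b, w 1 b * ‖A₁ b‖ < ε) →
        (∀ (b : PBond (F.P K) 0) (ν : Fin (F.P K).d), w 2 b * ((F.P K).L : ℝ) ^ (K - n) * ‖A₁ ⟨b.src.shift ν, b.dir⟩ - A₁ b‖ < ε) →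
        (∀ b, A₁ b ∈ herm0 (Fin N)) → (∀ b, δ b ∈ herm0 (Fin N)) →
        (fderiv ℂ (chartLogFlat (((((F.P K).L : ℝ))⁻¹) ^ (K - n)) D :
          (PBond (F.P K) 0 → Matrix (Fin N) (Fin N) ℂ) → BondIdx D → Matrix (Fin N) (Fin N) ℂ) 0) δ = 0 →
        ∀ (U₁ : GaugeField (F.P K) 0 (SU N)),
          (∀ b, ((U₁ b : SU N) : Matrix (Fin N) (Fin N) ℂ) = ((expCfg ((((F.P K).L : ℝ)⁻¹) ^ (K - n)) (A₁ - H (Dsel A₁)) b : (Matrix (Fin N) (Fin N) ℂ)ˣ) : _)) →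
          -- the criticality of the charted configuration, CELL FORM (print's (ii)-reading of [15] (156)–(157); no determining set)
          (∀ γ : ℝ → GaugeField (F.P K) 0 (SU N), γ 0 = U₁ →
            DifferentiableAt ℝ (fun (t : ℝ) (b : PBond (F.P K) 0) => ((γ t b : SU N) : Matrix (Fin N) (Fin N) ℂ)) 0 →
            (∀ (t : ℝ) (j : ℕ) (c : PBond (F.P K) j), j ≤ K - n → D.LamBond j c →
              avgFamily (avOfRecord F N K) (γ t) j c = avgFamily (avOfRecord F N K) U₁ j c) →
            HasDerivAt (fun t => wilsonAction4 (γ t)) 0 0) →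
        ∀ (X₁ δX : TangentBondSU (F.P K) 0 N),
          (∀ b, ((X₁ b : lieSU (Fin N)) : Matrix (Fin N) (Fin N) ℂ) = (Complex.I * (((((F.P K).L : ℝ)⁻¹) ^ (K - n) : ℝ) : ℂ)) • A₁ b) →
          (∀ b, ((δX b : lieSU (Fin N)) : Matrix (Fin N) (Fin N) ℂ) = (Complex.I * (((((F.P K).L : ℝ)⁻¹) ^ (K - n) : ℝ) : ℂ)) • δ b) →
          ⟪δX, hessOpAt ((((F.P K).L : ℝ)⁻¹) ^ (K - n)) (1 : GaugeField (F.P K) 0 (SU N)) X₁⟫_ℝ + (BE (W A₁) δ).re = 0) := by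
  obtain ⟨Mh₀, R₀, ε, C₄, hε, hC₄, hmain⟩ := exists_sectF_W_flatScaled_atRecord_herm0 N F
  obtain ⟨Mh₁, R₁, Bf, hBf, hrows⟩ := rescaledRows_of_adm22_T4 F
  have hL1 : (1 : ℝ) ≤ F.L := by exact_mod_cast F.hL.2.le
  have hL0 : (0 : ℝ) < (F.L : ℝ) := by linarith
  -- dag-k0-s1-w1's radius, a function of `L` and `N`
  obtain ⟨ℓr, hℓr⟩ : ∃ ℓr : ℝ, ℓr = ((((4 : ℕ) + 2) * F.L : ℕ) : ℝ) := ⟨_, rfl⟩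
  have hℓ1 : (1 : ℝ) ≤ ℓr := by
    rw [hℓr]; exact_mod_cast Nat.one_le_iff_ne_zero.mpr (Nat.mul_ne_zero (by omega) (by have := F.hL.2; omega))
  have hδN : 0 < deltaSU (Fin N) := deltaSU_pos
  obtain ⟨R, hRdef⟩ : ∃ R : ℝ, R = min (1 / (60800 * ℓr ^ 2 * (F.L : ℝ))) (deltaSU (Fin N) / (120 * ℓr ^ 2 * (F.L : ℝ))) := ⟨_, rfl⟩
  have hR0 : 0 < R := by rw [hRdef]; exact lt_min (by positivity) (by positivity)
  have hRL : 60800 * ℓr ^ 2 * (F.L : ℝ) * R ≤ 1 := by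
    have h : R ≤ 1 / (60800 * ℓr ^ 2 * (F.L : ℝ)) := by rw [hRdef]; exact min_le_left _ _
    rw [le_div_iff₀ (by positivity)] at h
    linarith
  have hguard : 60 * ℓr ^ 2 * (F.L : ℝ) * R < deltaSU (Fin N) := by
    have h : R ≤ deltaSU (Fin N) / (120 * ℓr ^ 2 * (F.L : ℝ)) := by rw [hRdef]; exact min_le_right _ _
    rw [le_div_iff₀ (by positivity)] at h
    nlinarith
  -- the radius of this file: inside D‴'s, at most `1`, and small against `R`
  have hBC : 0 < 1 + Bf * C₄ := by have := mul_nonneg hBf hC₄; linarith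
  obtain ⟨ε', hε'def⟩ : ∃ ε' : ℝ, ε' = min ε (min 1 (R / (2 * (1 + Bf * C₄)))) := ⟨_, rfl⟩
  have hε'pos : 0 < ε' := by rw [hε'def]; exact lt_min hε (lt_min one_pos (by positivity))
  have hε'le : ε' ≤ ε := by rw [hε'def]; exact min_le_left _ _
  have hε'1 : ε' ≤ 1 := by rw [hε'def]; exact (min_le_right _ _).trans (min_le_left _ _)
  have hε'R : ε' + Bf * C₄ * ε' ^ 2 ≤ R := by
    have h1 : ε' ≤ R / (2 * (1 + Bf * C₄)) := by rw [hε'def]; exact (min_le_right _ _).trans (min_le_right _ _)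
    rw [le_div_iff₀ (by positivity)] at h1
    have h2 : ε' ^ 2 ≤ ε' := by nlinarith
    nlinarith [mul_nonneg hBf hC₄, mul_le_mul_of_nonneg_left h2 (mul_nonneg hBf hC₄)]
  refine ⟨max Mh₀ Mh₁, max (max R₀ R₁) 2, ε', C₄, hε'pos, hC₄, ?_⟩
  intro n K hk1 hk' Mh R' a' hMha hMh hR' hsize D hDk hAdm w hw
  have hMh₀ : Mh₀ ≤ Mh := le_trans (le_max_left _ _) hMh
  have hMh₁ : Mh₁ ≤ Mh := le_trans (le_max_right _ _) hMh
  have hR₀ : R₀ ≤ R' := le_trans (le_trans (le_max_left _ _) (le_max_left _ _)) hR'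
  have hR₁ : R₁ ≤ R' := le_trans (le_trans (le_max_right _ _) (le_max_left _ _)) hR'
  have hR2 : 2 ≤ R' := le_trans (le_max_right _ _) hR'
  obtain ⟨τ, ρ, BE, B, hc, hwa, MV, H, Dsel, Qt, Ht, Dt, e, W, hntr, hρ, hBE, hB, hMV, hH, h55, hcd, hfix, hherm, hQt, hHt, hDt, he, h157, hdiff, h158⟩ :=
    hmain n K hk1 hk' hMha hMh₀ hR₀ hsize D hDk hAdm hw
  -- the row of `H♭` (dag-k0-s1-w4)
  have hν : ∀ t : BondIdx D, |(((F.P K).L : ℝ) ^ (t.1.1 : ℕ) * ((((F.P K).L : ℝ))⁻¹) ^ (K - n))⁻¹| ≤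
      (((F.P K).L : ℝ) ^ (t.1.1 : ℕ) * ((((F.P K).L : ℝ))⁻¹) ^ (K - n))⁻¹ := fun t => by
    have : (0 : ℝ) < ((F.P K).L : ℝ) := by exact_mod_cast (F.P K).L_pos
    rw [abs_of_pos (by positivity)]
  obtain ⟨hHB, -⟩ := hrows n K hk1 hk' hMha hMh₁ hR₁ hsize D hDk hAdm w hw (𝔸 := Matrix (Fin N) (Fin N) ℂ)
    (fun t => (((F.P K).L : ℝ) ^ (t.1.1 : ℕ) * ((((F.P K).L : ℝ))⁻¹) ^ (K - n))⁻¹) hν (fun X => H X) hH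
  -- the collar of the family
  have hMh1 : 1 ≤ Mh := by rw [hMha]; exact Nat.one_le_pow _ _ (F.P K).L_pos
  have hRM : 2 * (F.P K).L ≤ R' * (F.L * Mh) + 1 := by
    have hPL : (F.P K).L = F.L := rfl
    rw [hPL]
    calc 2 * F.L ≤ R' * (F.L * 1) := by rw [mul_one]; exact Nat.mul_le_mul_right _ hR2
      _ ≤ R' * (F.L * Mh) := Nat.mul_le_mul_left _ (Nat.mul_le_mul_left _ hMh1)
      _ ≤ R' * (F.L * Mh) + 1 := Nat.le_succ _
  have hcollar := collar_of_adm22 D hAdm hRM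
  -- the budgets in the record's letters
  have hRL' : 60800 * ((((F.P K).d + 2) * (F.P K).L : ℕ) : ℝ) ^ 2 * ((F.P K).L : ℝ) * R ≤ 1 := by
    rw [hℓr] at hRL; simpa only [T4Family.P_L, T4Family.P_d] using hRL
  have hguard' : 60 * ((((F.P K).d + 2) * (F.P K).L : ℕ) : ℝ) ^ 2 * ((F.P K).L : ℝ) * R < deltaSU (Fin N) := by
    rw [hℓr] at hguard; simpa only [T4Family.P_L, T4Family.P_d] using hguard
  -- D‴'s letters on the smaller radius
  have h55' : ∀ A' : PBond (F.P K) 0 → Matrix (Fin N) (Fin N) ℂ, (∀ b, w 1 b * ‖A' b‖ < ε') →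
      ∀ ρ' : ℝ, 0 ≤ ρ' → (∀ b, w 1 b * ‖A' b‖ ≤ ρ') → ∀ i : BondIdx D, ‖Dsel A' i‖ ≤ C₄ * ρ' ^ 2 :=
    fun A' hA' ρ' hρ' hle i => h55 A' (fun b => (hA' b).trans_le hε'le) ρ' hρ' hle i
  have hcd' : ContDiffOn ℂ ω Dsel {Y : PBond (F.P K) 0 → Matrix (Fin N) (Fin N) ℂ | ∀ b, w 1 b * ‖Y b‖ < ε'} :=
    hcd.mono fun Y hY b => (hY b).trans_le hε'le
  have hfix' : ∀ A' : PBond (F.P K) 0 → Matrix (Fin N) (Fin N) ℂ, (∀ b, w 1 b * ‖A' b‖ < ε') →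
      chartLogFlat (((((F.P K).L : ℝ))⁻¹) ^ (K - n)) D (A' - H (Dsel A')) - (fderiv ℂ (chartLogFlat (((((F.P K).L : ℝ))⁻¹) ^ (K - n)) D :
        (PBond (F.P K) 0 → Matrix (Fin N) (Fin N) ℂ) → BondIdx D → Matrix (Fin N) (Fin N) ℂ) 0) (A' - H (Dsel A')) = Dsel A' ∧
      chartLogFlat (((((F.P K).L : ℝ))⁻¹) ^ (K - n)) D (A' - H (Dsel A')) = (fderiv ℂ (chartLogFlat (((((F.P K).L : ℝ))⁻¹) ^ (K - n)) D :
        (PBond (F.P K) 0 → Matrix (Fin N) (Fin N) ℂ) → BondIdx D → Matrix (Fin N) (Fin N) ℂ) 0) A' :=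
    fun A' hA' => hfix A' fun b => (hA' b).trans_le hε'le
  have hherm' : ∀ A' : PBond (F.P K) 0 → Matrix (Fin N) (Fin N) ℂ, (∀ b, w 1 b * ‖A' b‖ < ε') → (∀ b, A' b ∈ herm0 (Fin N)) →
      (∀ i, Dsel A' i ∈ herm0 (Fin N)) ∧ ∀ b, (A' - H (Dsel A')) b ∈ herm0 (Fin N) :=
    fun A' hA' hA'h => hherm A' (fun b => (hA' b).trans_le hε'le) hA'h
  refine ⟨τ, ρ, BE, B, hc, hwa, MV, H, Dsel, Qt, Ht, Dt, e, W, hntr, hρ, hBE, hB, hMV, hH, h55', hcd', hfix', hherm', hQt, hHt, hDt, he,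
    fun A' hA' hA'2 => h157 A' (fun b => (hA' b).trans_le hε'le) (fun b ν => (hA'2 b ν).trans_le hε'le),
    hdiff.mono fun Y hY => ⟨fun b => (hY.1 b).trans_le hε'le, fun b ν => (hY.2 b ν).trans_le hε'le⟩,
    fun Y r hr h1 h2 b => h158 Y r (hr.trans_le hε'le) h1 h2 b, ?_⟩
  -- the socket
  intro A₁ δ hA₁ hA₁2 hA₁h hδh hδQ U₁ hU₁ hcrit X₁ δX hX₁ hδX
  exact socket127_flat_of_letters_lam F N K (K - n) D hDk hcollar hw hc hwa τ hntr B hB MV hMV H hH hBf hHB Dsel hε'pos hC₄ h55' hcd'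
    (fun A' hA' => (hfix' A' hA').2) hherm' hRL' hguard' hε'R A₁ δ hA₁ hA₁h hδh hδQ
    (h157 A₁ (fun b => (hA₁ b).trans_le hε'le) (fun b ν => (hA₁2 b ν).trans_le hε'le)) U₁ hU₁ hcrit X₁ δX hX₁ hδX

end Summit.QuantumFields.YangMills.BalabanUVNodes.N07SocketFlatAtRecordExistsLam

end
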